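import Literature.NumberTheory.EllipticCurves.PastenValuationProductConsequences
import HarnessLib

/-!
# `PastenValuationProduct` — proofs index

Topic `NumberTheory/EllipticCurves`; namespace `Literature.NumberTheory.EllipticCurves`.
Proofs sibling of `Literature/NumberTheory/EllipticCurves/PastenValuationProduct.lean`
(H. Pasten, *Shimura curves and the abc conjecture*, J. Number Theory 254 (2024) 214–335 =
arXiv:1705.09251: Thms 1.12, 1.15, 7.5, Cor 16.2, Conj 1.14, and the Mestre–Oesterlé input).

**Why this file is (almost) empty.** On 2026-08-15 several fact-proving units, one per named fact
of `PastenValuationProduct.lean`, proposed WHOLE files to this single sibling path concurrently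
(ledger p41105, p41492, p42293, p42643, …); each accepted submission silently replaced the previous
unit's theorems (the gate allows removing declarations nothing references). To end that, the
per-result proofs live in separately named siblings, one per unit, and this path only keeps the
index below plus one elementary remark:

* `PastenValuationProductSemistableProofs.lean` — Thm 1.12 / 16.5 and Cor 16.2 (renderings,
  first paragraph of the proof of Thm 16.5);
* `PastenValuationProductMestreOesterleProofs.lean` — the Mestre–Oesterlé prime-conductor input;
* `PastenValuationProductThm75Proofs.lean` — Thm 7.5 (classical modular approach to Szpiro)
  assembled from its printed inputs (`pasten_thm_7_5_of_classicalModularApproach`);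
* units working on Thm 1.15 / the Tamagawa side (whose theorems `localTamagawaNumber_…`,
  `exists_tamagawaProduct_le_of_conductorNorm_lt`, … were displaced from this path by p42643)
  should re-land them verbatim in a further `PastenValuationProduct<Topic>Proofs.lean`; nothing
  here needs merging, and a whole-file resubmission of this path that drops the remark below is
  harmless.

## Contents

* `pasten_thm_1_15_semistable_of_smallTamagawa` — the semistable clause of the folklore remark
  "Conjecture 1.14 ⟹ Thm 1.15", keyed to the CANONICAL conjecture leaf
  `Summit.ABC.ABC.SmallTamagawaConjecture` (conjecture/notion split, coordinator 2026-08-15: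
  unproven conjectures are obligations of the summit, not Literature facts). The full remark
  (both clauses), formerly here as `pasten_thm_1_15_of_smallTamagawaConjecture` keyed to the
  retired Literature duplicate of the conjecture, is
  `PastenValuationProductConsequences.pasten_thm_1_15_of_smallTamagawa`.
-/

noncomputable section

namespace Literature.NumberTheory.EllipticCurves

/-- **Conj 1.14 ⟹ Thm 1.15, semistable clause** (keyed to the canonical conjecture
`Summit.ABC.ABC.SmallTamagawaConjecture`; both clauses: `pasten_thm_1_15_of_smallTamagawa`).
[cite: PastenShimura2024, Conjecture 1.14, Theorem 1.15] -/
theorem pasten_thm_1_15_semistable_of_smallTamagawa (h : Summit.ABC.ABC.SmallTamagawaConjecture) :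
    pasten_thm_1_15_semistable :=
  (pasten_thm_1_15_of_smallTamagawa h).2

end Literature.NumberTheory.EllipticCurves

end
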